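import Mathlib
import Summits.Ventures.FusionMHD.Models.SAlphaPolyWitnessS25A1625Panels0
import HarnessLib

/-!
# F3 «F3.BALLOON-sα-S25-A1625-POLY-WITNESS»: at `(s, α) = (5/2, 13/8)` the `s–α` ballooning MODEL is on the UNSTABLE side — an explicit polynomial trial function on the window `[−4, 4]` with kernel-certified NEGATIVE energy (`SAlpha.UnstableWitness (5/2) (13/8) (−4) 4`); the UPPER end of the `s = 5/2` bracket of record `[5/4, 7/4]` moves to `13/8`

LADDER-GRIDFUSION rung F3 (cell `gridfusion`; DIRECTOR RULING 67 (3) / lead g14 RULING 9ft (7): at `s = 5/2` the bracket of record is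
`[5/4, 7/4]` (★ #227, width `1/2`); a COUNTED half-gap END MOVE needs width `≤ 1/4` — the float edge `≈ 1.49` sits `0.01` below the midpoint, so
no single-end move is realistic: THIS file supplies the UPPER end `13/8`; together with a stable end at `α ≥ 11/8` (proposed split model-7 / lit-4,
HOME STATUS 08:5xZ) the bracket becomes `[11/8, 13/8]`, width `1/4`).  Assembly by gridfusion-model-7 g9, 2026-08-28, in model-7's poly-witness lane
(g8, ★ #231 `SAlphaPolyWitnessS2A125*`) of (i) the data file `SAlphaPolyWitnessS25A1625Defs` (the even degree-18 polynomial `X = UX`, `X(±4) = 0`,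
and the 22-statement density program `pw4Prog`), (ii) ONE panel file `SAlphaPolyWitnessS25A1625Panels0` (9 kernel-decided Taylor-model integral
enclosures of the density on a GRADED grid of `[0, 4]` — half-width `1/4` on `[0, 7/2]`, `1/8` on `[7/2, 4]` — glued by `FSegOK.append`, the grid
change after rewriting the common endpoint), and (iii) here: `Poly.deriv UX = UXd` (`decide`), the exact zeros `X(±4) = 0`, parity (`X` even, `X′`
odd ⇒ density even ⇒ `W[X; −4, 4] = 2∫₀⁴`), `FSegOK.bounds`, and lit-3's predicate `SAlpha.UnstableWitness`.  0 kit in the kernel objects; no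
`native_decide`; `π` does not enter.

## THREE COLUMNS
CERTIFIED: in the `s–α` ballooning MODEL (Freidberg (12.96)–(12.99)) at `(s, α) = (5/2, 13/8)` the explicit trial function `X = Poly.eval UX` on
`[−4, 4]` (even polynomial of degree 18 vanishing at `±4`) has one-surface energy `W ≤ −7/100 < 0` (`X(0) ≈ 1`):
`SAlpha.UnstableWitness (5/2) (13/8) (−4) 4 X X′` (`unstableWitness_fiveHalves_138`).  With gridfusion-lit-4's ★ #227 `SAlphaStableS25A125.stableSide :
SAlpha.StableSide (5/2) (5/4)` the unstable set `U_{5/2}` of the MODEL at shear `s = 5/2` (the `α` at which some compact window carries a witness)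
misses `5/4` and contains `13/8` (and `7/4`, ★ #192 / `SAlphaQuarticBumpShears.unstableWitness_tt_fiveHalves_74`): `inf {α ≥ 5/4 : α ∈ U_{5/2}}` lies in
the CLOSED interval `[5/4, 13/8]` (width `3/8`; NOT yet a halving of `[5/4, 7/4]` — that needs the stable end `11/8`); monotonicity / continuity in
`α` NOT typed.  VALIDATED (not in the kernel): E–L shooting puts the edge at `α ≈ 1.49` (lit-4 kit j299948 / j301608; model-7 RK4: first zero of
the even solution at `θ ≈ 3.39` for `α = 13/8`); float energy of `X` `≈ −0.0744`, kernel enclosure of the half integral `[−0.037254, −0.037179]`;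
the printed fit `α ≈ 0.6 s` (12.100) gives `1.5`.  MODELLED: `s–α` model (large-aspect-ratio shifted circles, high-`n` ballooning ordering,
`θ₀ = 0`, ideal MHD); «unstable» = the MODEL's one-surface energy admits a negative compactly supported trial function (lit-3's witness class;
representation step `W̄ < 0 ⇒ δW < 0`, Connor–Hastie–Taylor 1979, quoted in the Literature file, NOT typed); no device, no `β`-limit, no
second-stability claim.  Citations: Freidberg 2014 §12.3 (12.38)–(12.40), §12.6.2 (12.97)–(12.100) [Freidberg2014]; Mahboubi–Melquiond–Sibut-Pinote
2016 [MahboubiMelquiondSibutpinote2016]; Makino–Berz 2003 [MakinoBerz2003].  Everything below is [instance data].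
-/

open MeasureTheory
open Literature.Analysis.ValidatedNumerics Literature.Analysis.ValidatedNumerics.PolyMP
open Literature.Analysis.ValidatedNumerics.NumericsMP Literature.Analysis.ValidatedNumerics.ExpPoly
open Literature.MathematicalPhysics.MHD.Ballooning
open Real Set

namespace Summit.Ventures.FusionMHD.Models

namespace SAlphaPolyWitnessS25A1625

/-! ### §1 The trial function: derivative, zeros at `±4`, parity -/

/-- `Poly.deriv UX = UXd`. [instance data] -/
private theorem deriv_UX : Poly.deriv UX = UXd := by
  decide +kernel

/-- `X(4) = 0` (exact). [instance data] -/
private theorem UX_at_L : Poly.eval UX (4 : ℝ) = 0 := by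
  norm_num [UX, Poly.eval]

/-- `X(−4) = 0` (exact). [instance data] -/
private theorem UX_at_negL : Poly.eval UX (-4 : ℝ) = 0 := by
  norm_num [UX, Poly.eval]

/-- `X` is even. [instance data] -/
private theorem UX_even (θ : ℝ) : Poly.eval UX (-θ) = Poly.eval UX θ := by
  simp only [UX, Poly.eval]
  push_cast
  ring

/-- `X′` is odd. [instance data] -/
private theorem UXd_odd (θ : ℝ) : Poly.eval UXd (-θ) = -Poly.eval UXd θ := by
  simp only [UXd, Poly.eval]
  push_cast
  ring

/-- `X′ = Poly.eval UXd` is the derivative of `X = Poly.eval UX` everywhere. [instance data] -/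
private theorem hasDerivAt_UX (θ : ℝ) : HasDerivAt (Poly.eval UX) (Poly.eval UXd θ) θ := by
  have h := Poly.hasDerivAt_eval UX θ
  rwa [deriv_UX] at h

/-! ### §2 The energy density of `X`: parity, continuity, the certified half-window integral -/

/-- The energy density of the even `X` is even in `θ`. [instance data] -/
private theorem density_even (θ : ℝ) : (SAlpha.energyDensity (5 / 2) (13 / 8) (Poly.eval UX) (Poly.eval UXd)) (-θ) = (SAlpha.energyDensity (5 / 2) (13 / 8) (Poly.eval UX) (Poly.eval UXd)) θ := by
  unfold SAlpha.energyDensity SAlpha.bending SAlpha.drive SAlpha.shearParam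
  rw [UX_even, UXd_odd, Real.sin_neg, Real.cos_neg]
  ring

/-- The energy density of `X` is continuous. [instance data] -/
private theorem density_continuous : Continuous (SAlpha.energyDensity (5 / 2) (13 / 8) (Poly.eval UX) (Poly.eval UXd)) := by
  have h1 : Continuous (Poly.eval UX) := Poly.continuous_eval UX
  have h2 : Continuous (Poly.eval UXd) := Poly.continuous_eval UXd
  unfold SAlpha.energyDensity SAlpha.bending SAlpha.drive SAlpha.shearParam
  fun_prop

/-- THE CERTIFIED HALF-WINDOW INTEGRAL: `∫₀^4 [(1+Λ²)X′² − α(Λ sin θ + cos θ)X²] dθ ≤ -7/200` (kernel enclosure of the 9 panels: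
`[-0.037254, -0.037179]`; float value `-0.037216`). [instance data] -/
theorem half_integral_le : ∫ θ in (0 : ℝ)..4, (SAlpha.energyDensity (5 / 2) (13 / 8) (Poly.eval UX) (Poly.eval UXd)) θ ≤ (-7 / 200 : ℝ) := by
  have hseg := pw4_seg0
  have hb := (hseg.bounds (by norm_num) (lo' := -1) (hi' := -7/200) (by norm_num) (by norm_num)).2
  have e0 : ((panelLeft (1/4 : ℚ) 0 : ℚ) : ℝ) = 0 := by norm_num [panelLeft]
  have e1 : ((panelLeft (1/8 : ℚ) 16 : ℚ) : ℝ) = 4 := by norm_num [panelLeft]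
  have ei : ∀ t : ℝ, (TProg.toFunP (pw4Prog UX UXd) []) t * Poly.eval [1] t = (SAlpha.energyDensity (5 / 2) (13 / 8) (Poly.eval UX) (Poly.eval UXd)) t := by
    intro t
    rw [toFunP_pw4Prog]
    simp [Poly.eval]
  rw [e0, e1] at hb
  simp only [ei] at hb
  norm_num at hb ⊢
  exact hb

/-- THE CERTIFIED ENERGY: `W[X; −4, 4] ≤ -7/100 < 0` (reflection `θ ↦ −θ` doubles the half-window integral). [instance data] -/
theorem energy_le : SAlpha.energy (5 / 2) (13 / 8) (Poly.eval UX) (Poly.eval UXd) (-4) 4 ≤ (-7 / 100 : ℝ) := by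
  unfold SAlpha.energy
  have hint : ∀ a b : ℝ, IntervalIntegrable (SAlpha.energyDensity (5 / 2) (13 / 8) (Poly.eval UX) (Poly.eval UXd)) volume a b :=
    fun a b => density_continuous.intervalIntegrable a b
  have hsplit := intervalIntegral.integral_add_adjacent_intervals (hint (-4) 0) (hint 0 4)
  have hrefl : ∫ θ in (-4 : ℝ)..0, (SAlpha.energyDensity (5 / 2) (13 / 8) (Poly.eval UX) (Poly.eval UXd)) θ = ∫ θ in (0 : ℝ)..4, (SAlpha.energyDensity (5 / 2) (13 / 8) (Poly.eval UX) (Poly.eval UXd)) θ := by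
    have h1 := intervalIntegral.integral_comp_neg (a := (0 : ℝ)) (b := 4) (SAlpha.energyDensity (5 / 2) (13 / 8) (Poly.eval UX) (Poly.eval UXd))
    simp only [neg_zero] at h1
    rw [← h1]
    exact intervalIntegral.integral_congr fun x _ => density_even x
  have hh := half_integral_le
  linarith

/-! ### §3 The witness -/

/-- **THE ROW: `(s, α) = (5/2, 13/8)` IS ON THE UNSTABLE SIDE OF THE `s–α` MODEL** — the explicit even polynomial `X = Poly.eval UX`
(degree 18, `X(±4) = 0`) is a compactly supported trial function on the window `[−4, 4]` with NEGATIVE one-surface energy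
(`≤ -7/100` with `X(0) ≈ 1`), i.e. an `SAlpha.UnstableWitness 5/2 (13/8) (−4) 4`.  MODEL `s–α`; «unstable» in the model's own one-surface (Newcomb / trial-function)
sense; nothing about a device. [instance data] -/
theorem unstableWitness_fiveHalves_138 : SAlpha.UnstableWitness (5 / 2) (13 / 8) (-4) 4 (Poly.eval UX) (Poly.eval UXd) := by
  refine ⟨by norm_num, fun θ _ => hasDerivAt_UX θ, UX_at_negL, UX_at_L, ?_⟩
  have h := energy_le
  linarith

end SAlphaPolyWitnessS25A1625

end Summit.Ventures.FusionMHD.Models
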